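import Summits.Parity.BatemanHorn.Theorems.RoughParitySectorsOddSectorShareLinearOneFormShare
import Literature.NumberTheory.Sieve.BombieriAsymptoticSieveOddShare
import HarnessLib

/-!
# Route `RoughParitySectors`, crux `OddSectorShareLinear` (stmt-Parity-15629), line `birth`:
# the sieve sequence along a linear member on a background — fibres and cells

`--supports stmt-Parity-15629` file (line lead, cycle 2). For a linear member `g = a·X + b` (`a ≥ 1`)
and a background predicate `B` on `n`, consider any weight `w : ℕ → ℝ` with `w v = 1` if some `n ≥ 1`
on `B` has `g(n) = v` and `w v = 0` otherwise (the sequence "along `g` on `B`"). Then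
* `sum_weight_eq_card` (= registered sub-goal `stub_alongSumEqCard`) — `∑_{v ∈ S} w v =
  #{1 ≤ n ≤ x : B n, g(n) ∈ S}` for sets `S` of values in `[1, g(x)]` (fibres of the injective `g`);
* `primeCellAt_eq_card` — the prime cell `C₁(y; g(x))` of the sequence
  (`Literature.NumberTheory.Sieve.BombieriRoughCells.roughCellAt … 1`) is `#{n ≤ x : B n, g(n) prime ≥ y}`;
* `oddCells_eq_card` — its odd sector `Odd_R(y; g(x))` (`BombieriRoughCells.oddCells`) is
  `#{n ≤ x : B n, g(n) squarefree, ω(g(n)) odd ≤ R, p_min(g(n)) ≥ y}`.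
These turn `BombieriRoughCells.primeShare_of_floor` into a statement about the crux's mixed cells on
the background "all other members prime" (`…PrimeBackground.lean`). No definition, no new fact.
-/

noncomputable section

open Filter Finset Polynomial
open scoped BigOperators Topology ArithmeticFunction.omega ArithmeticFunction.Omega
open Literature.NumberTheory.Sieve

namespace Summit.Parity.BatemanHorn.Cruxes.OddSectorShareLinear.Birth

namespace PrimeBackground

/-- **Fibre identity.** Let `g = a·X + b` (`a ≥ 1`) be the last member and let the weight `w v` be `1`
if some `n ≥ 1` on the background `B` (a predicate on `n`) has `g(n) = v`, and `0` otherwise.  Then for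
every finite set `S` of values `v ≥ 1` with `v ≤ g(x)`, `∑_{v ∈ S} w v = #{1 ≤ n ≤ x : B n, g(n) ∈ S}`
(`g` is injective on `ℕ` and `g(n) ≤ g(x) ⇒ n ≤ x`). [folklore] -/
theorem sum_weight_eq_card {a b : ℤ} (ha : 0 < a) (B : ℕ → Prop) [DecidablePred B] {w : ℕ → ℝ}
    (hw1 : ∀ v : ℕ, (∃ n : ℕ, 1 ≤ n ∧ a * n + b = v ∧ B n) → w v = 1)
    (hw0 : ∀ v : ℕ, (¬ ∃ n : ℕ, 1 ≤ n ∧ a * n + b = v ∧ B n) → w v = 0)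
    (x : ℕ) (S : Finset ℕ) (hS : ∀ v ∈ S, 1 ≤ v ∧ (v : ℤ) ≤ a * x + b) :
    ∑ v ∈ S, w v = ((((Finset.Icc 1 x).filter (fun n : ℕ => B n)).filter
      (fun n : ℕ => (a * n + b).toNat ∈ S)).card : ℝ) := by
  set N := (Finset.Icc 1 x).filter (fun n : ℕ => B n) with hN
  set φ : ℕ → ℕ := fun n => (a * n + b).toNat with hφ
  have hmaps : ∀ n ∈ N.filter (fun n : ℕ => φ n ∈ S), φ n ∈ S := fun n hn => (Finset.mem_filter.mp hn).2
  rw [Finset.card_eq_sum_card_fiberwise hmaps, Nat.cast_sum]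
  refine Finset.sum_congr rfl fun v hv => ?_
  obtain ⟨hv1, hvx⟩ := hS v hv
  have hfib : (N.filter (fun n : ℕ => φ n ∈ S)).filter (fun n : ℕ => φ n = v) =
      N.filter (fun n : ℕ => φ n = v) := by
    ext n
    simp only [Finset.mem_filter]
    constructor
    · rintro ⟨⟨h1, _⟩, h3⟩; exact ⟨h1, h3⟩
    · rintro ⟨h1, h3⟩; exact ⟨⟨h1, h3 ▸ hv⟩, h3⟩
  rw [hfib]
  -- a solution `n` of `φ n = v` in `N` has `a n + b = v`
  have hsol : ∀ n ∈ N.filter (fun n : ℕ => φ n = v), 1 ≤ n ∧ a * n + b = v ∧ B n := by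
    intro n hn
    rw [Finset.mem_filter, hN, Finset.mem_filter, Finset.mem_Icc] at hn
    obtain ⟨⟨⟨hn1, _⟩, hB⟩, hφn⟩ := hn
    refine ⟨hn1, ?_, hB⟩
    have hpos : 0 ≤ a * n + b := by
      by_contra hneg
      have : φ n = 0 := Int.toNat_of_nonpos (not_le.mp hneg).le
      omega
    rw [← Int.toNat_of_nonneg hpos]
    exact_mod_cast hφn
  by_cases hex : ∃ n : ℕ, 1 ≤ n ∧ a * n + b = v ∧ B n
  · rw [hw1 v hex]
    obtain ⟨n₀, hn₀1, hn₀v, hB₀⟩ := hex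
    have hn₀x : n₀ ≤ x := by
      have : a * n₀ + b ≤ a * x + b := hn₀v ▸ hvx
      have : (n₀ : ℤ) ≤ x := le_of_mul_le_mul_left (by linarith) ha
      exact_mod_cast this
    have heq : N.filter (fun n : ℕ => φ n = v) = {n₀} := by
      ext n
      rw [Finset.mem_singleton]
      constructor
      · intro hn
        obtain ⟨_, hnv, _⟩ := hsol n hn
        have : a * n = a * n₀ := by linarith
        exact_mod_cast mul_left_cancel₀ ha.ne' this
      · rintro rfl
        rw [Finset.mem_filter, hN, Finset.mem_filter, Finset.mem_Icc]
        exact ⟨⟨⟨hn₀1, hn₀x⟩, hB₀⟩, by rw [hφ]; simp only [hn₀v, Int.toNat_natCast]⟩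
    rw [heq, Finset.card_singleton, Nat.cast_one]
  · rw [hw0 v hex]
    have hempty : N.filter (fun n : ℕ => φ n = v) = ∅ := by
      rw [Finset.eq_empty_iff_forall_notMem]
      intro n hn
      obtain ⟨hn1, hnv, hB⟩ := hsol n hn
      exact hex ⟨n, hn1, hnv, hB⟩
    rw [hempty, Finset.card_empty, Nat.cast_zero]

/-- **The prime cell of the sequence is a count on the background**: with `w` as above,
`C₁(y; X) = ∑_{p ≤ X, p ≥ y} w p = #{1 ≤ n ≤ x : B n, g(n) prime, g(n) ≥ y}` for `X = g(x) = a x + b`.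
[folklore] -/
theorem primeCellAt_eq_card {a b : ℤ} (ha : 0 < a) (B : ℕ → Prop) [DecidablePred B] {w : ℕ → ℝ}
    (hw1 : ∀ v : ℕ, (∃ n : ℕ, 1 ≤ n ∧ a * n + b = v ∧ B n) → w v = 1)
    (hw0 : ∀ v : ℕ, (¬ ∃ n : ℕ, 1 ≤ n ∧ a * n + b = v ∧ B n) → w v = 0)
    (x : ℕ) (y : ℝ) :
    ∑ p ∈ (Nat.primesLE (a * x + b).toNat).filter (fun p : ℕ => y ≤ (p : ℝ)), w p =
      ((((Finset.Icc 1 x).filter (fun n : ℕ => B n)).filter (fun n : ℕ =>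
        ((a * n + b).toNat).Prime ∧ y ≤ (((a * n + b).toNat : ℕ) : ℝ))).card : ℝ) := by
  rw [sum_weight_eq_card ha B hw1 hw0 x]
  · congr 2
    refine Finset.filter_congr fun n hn => ?_
    rw [Finset.mem_filter, Nat.mem_primesLE]
    rw [Finset.mem_filter, Finset.mem_Icc] at hn
    constructor
    · rintro ⟨⟨_, hp⟩, hy⟩; exact ⟨hp, hy⟩
    · rintro ⟨hp, hy⟩
      refine ⟨⟨?_, hp⟩, hy⟩
      -- `g(n) ≤ g(x)`
      have : a * n + b ≤ a * x + b := by
        have : (n : ℤ) ≤ x := by exact_mod_cast hn.1.2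
        nlinarith
      exact Int.toNat_le_toNat this
  · intro v hv
    rw [Finset.mem_filter, Nat.mem_primesLE] at hv
    obtain ⟨⟨hvle, hvp⟩, _⟩ := hv
    refine ⟨hvp.one_lt.le, ?_⟩
    rcases le_or_gt 0 (a * x + b) with h0 | h0
    · have : (v : ℤ) ≤ ((a * x + b).toNat : ℤ) := by exact_mod_cast hvle
      rwa [Int.toNat_of_nonneg h0] at this
    · exfalso
      have h2 : (a * x + b).toNat = 0 := Int.toNat_of_nonpos h0.le
      rw [h2] at hvle
      exact hvp.ne_zero (Nat.le_zero.mp hvle)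

/-- **The odd sector of the sequence is a count on the background**:
`Odd_R(y; X) = #{1 ≤ n ≤ x : B n, g(n) squarefree, ω(g(n)) odd, ω(g(n)) ≤ R, p_min(g(n)) ≥ y}` for
`X = g(x)`. [folklore] -/
theorem oddCells_eq_card {a b : ℤ} (ha : 0 < a) (B : ℕ → Prop) [DecidablePred B] {A : SieveSequence}
    (hw1 : ∀ v : ℕ, (∃ n : ℕ, 1 ≤ n ∧ a * n + b = v ∧ B n) → A.a v = 1)
    (hw0 : ∀ v : ℕ, (¬ ∃ n : ℕ, 1 ≤ n ∧ a * n + b = v ∧ B n) → A.a v = 0)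
    (x R : ℕ) (y : ℝ) :
    BombieriRoughCells.oddCells A R y (((a * x + b).toNat : ℕ) : ℝ) =
      ((((Finset.Icc 1 x).filter (fun n : ℕ => B n)).filter (fun n : ℕ =>
        Squarefree ((a * n + b).toNat) ∧ Odd (ω ((a * n + b).toNat)) ∧ ω ((a * n + b).toNat) ≤ R ∧
          y ≤ ((Nat.minFac ((a * n + b).toNat) : ℕ) : ℝ))).card : ℝ) := by
  set N := (Finset.Icc 1 x).filter (fun n : ℕ => B n) with hN
  set φ : ℕ → ℕ := fun n => (a * n + b).toNat with hφ
  have hfl : ⌊(((a * x + b).toNat : ℕ) : ℝ)⌋₊ = (a * x + b).toNat := Nat.floor_natCast _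
  -- each rough cell is a count
  have hcell : ∀ r : ℕ, BombieriRoughCells.roughCellAt A r y (((a * x + b).toNat : ℕ) : ℝ) =
      (((N.filter (fun n : ℕ => Squarefree (φ n) ∧ y ≤ ((Nat.minFac (φ n) : ℕ) : ℝ))).filter
        (fun n : ℕ => ω (φ n) = r)).card : ℝ) := by
    intro r
    unfold BombieriRoughCells.roughCellAt
    rw [hfl, sum_weight_eq_card ha B hw1 hw0 x (((Finset.Icc 1 (a * x + b).toNat).filter
      (fun v : ℕ => Squarefree v ∧ ω v = r)).filter (fun v : ℕ => y ≤ ((Nat.minFac v : ℕ) : ℝ)))]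
    · congr 1
      have hset : ((Finset.Icc 1 x).filter (fun n : ℕ => B n)).filter (fun n : ℕ => (a * n + b).toNat ∈
          ((Finset.Icc 1 (a * x + b).toNat).filter (fun v : ℕ => Squarefree v ∧ ω v = r)).filter
            (fun v : ℕ => y ≤ ((Nat.minFac v : ℕ) : ℝ))) =
          (N.filter (fun n : ℕ => Squarefree (φ n) ∧ y ≤ ((Nat.minFac (φ n) : ℕ) : ℝ))).filter
            (fun n : ℕ => ω (φ n) = r) := by
        ext n
        simp only [hN, hφ, Finset.mem_filter, Finset.mem_Icc]
        constructor
        · rintro ⟨hnB, ⟨⟨_, _⟩, hsq, hω⟩, hy⟩; exact ⟨⟨hnB, hsq, hy⟩, hω⟩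
        · rintro ⟨⟨hnB, hsq, hy⟩, hω⟩
          refine ⟨hnB, ⟨⟨?_, ?_⟩, hsq, hω⟩, hy⟩
          · exact Nat.pos_of_ne_zero fun h => by rw [h] at hsq; exact not_squarefree_zero hsq
          · have : a * n + b ≤ a * x + b := by
              have : (n : ℤ) ≤ x := by exact_mod_cast hnB.1.2
              nlinarith
            exact Int.toNat_le_toNat this
      rw [hset]
    · intro v hv
      simp only [Finset.mem_filter, Finset.mem_Icc] at hv
      refine ⟨hv.1.1.1, ?_⟩
      have h1 : (v : ℤ) ≤ ((a * x + b).toNat : ℤ) := by exact_mod_cast hv.1.1.2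
      rcases le_or_gt 0 (a * x + b) with h0 | h0
      · rwa [Int.toNat_of_nonneg h0] at h1
      · have : (a * x + b).toNat = 0 := Int.toNat_of_nonpos h0.le
        have : v = 0 := by have := hv.1.1.2; omega
        rw [this] at hv
        exact absurd hv.1.2.1 not_squarefree_zero
  unfold BombieriRoughCells.oddCells
  simp_rw [hcell]
  rw [← Nat.cast_sum]
  congr 1
  -- sum over odd `r ≤ R` of the fibres of `ω ∘ φ` = the count with `ω` odd and `≤ R`
  set N' := N.filter (fun n : ℕ => Squarefree (φ n) ∧ y ≤ ((Nat.minFac (φ n) : ℕ) : ℝ)) with hN'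
  have hmaps : ∀ n ∈ N'.filter (fun n : ℕ => Odd (ω (φ n)) ∧ ω (φ n) ≤ R),
      ω (φ n) ∈ (Finset.range (R + 1)).filter Odd := by
    intro n hn
    obtain ⟨_, hodd, hle⟩ := Finset.mem_filter.mp hn
    exact Finset.mem_filter.mpr ⟨Finset.mem_range.mpr (by omega), hodd⟩
  have key := Finset.card_eq_sum_card_fiberwise hmaps
  have hfib : ∀ r ∈ (Finset.range (R + 1)).filter Odd,
      (N'.filter (fun n : ℕ => Odd (ω (φ n)) ∧ ω (φ n) ≤ R)).filter (fun n : ℕ => ω (φ n) = r) =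
        N'.filter (fun n : ℕ => ω (φ n) = r) := by
    intro r hr
    obtain ⟨hrR, hro⟩ := Finset.mem_filter.mp hr
    have hrR' : r ≤ R := by have := Finset.mem_range.mp hrR; omega
    ext n
    simp only [Finset.mem_filter]
    constructor
    · rintro ⟨⟨h1, _⟩, h3⟩; exact ⟨h1, h3⟩
    · rintro ⟨h1, h3⟩; exact ⟨⟨h1, h3 ▸ hro, h3 ▸ hrR'⟩, h3⟩
  have hbig : N.filter (fun n : ℕ => Squarefree ((a * n + b).toNat) ∧ Odd (ω ((a * n + b).toNat)) ∧
      ω ((a * n + b).toNat) ≤ R ∧ y ≤ ((Nat.minFac ((a * n + b).toNat) : ℕ) : ℝ)) =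
      N'.filter (fun n : ℕ => Odd (ω (φ n)) ∧ ω (φ n) ≤ R) := by
    ext n
    simp only [hN', hφ, Finset.mem_filter]
    tauto
  rw [hbig, key]
  exact Finset.sum_congr rfl fun r hr => by rw [hfib r hr]

end PrimeBackground

/-- **Sub-goal (fibre identity of the prime-background step)**, registered on crux stmt-Parity-15629 as
`stub_alongSumEqCard`, verbatim: for the sequence along a linear member `a·X + b` on a background `B`
(weight `1` at `v` iff some `n ≥ 1` on `B` has `a n + b = v`), sums of the weights over values
`v ≤ a x + b` are counts of `n ≤ x` on the background (`PrimeBackground.sum_weight_eq_card`). [folklore] -/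
theorem stub_alongSumEqCard :
    ∀ (a b : ℤ), 0 < a → ∀ (B : ℕ → Prop) [DecidablePred B] (w : ℕ → ℝ), (∀ v : ℕ, (∃ n : ℕ, 1 ≤ n
    ∧ a * n + b = v ∧ B n) → w v = 1) → (∀ v : ℕ, (¬ ∃ n : ℕ, 1 ≤ n ∧ a * n + b = v ∧ B n) → w v = 0)
    → ∀ (x : ℕ) (S : Finset ℕ), (∀ v ∈ S, 1 ≤ v ∧ (v : ℤ) ≤ a * x + b) → ∑ v ∈ S, w v =
    ((((Finset.Icc 1 x).filter (fun n : ℕ => B n)).filter (fun n : ℕ => (a * n + b).toNat ∈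
    S)).card : ℝ) :=
  fun _ _ ha B _ _ hw1 hw0 x S hS => PrimeBackground.sum_weight_eq_card ha B hw1 hw0 x S hS

end Summit.Parity.BatemanHorn.Cruxes.OddSectorShareLinear.Birth

end
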